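import Summits.BirchSwinnertonDyer.BirchSwinnertonDyer.Theorems.ByReductionTypeAtTwoSupersingularFlatCountTwoOfPoitouTate
import Summits.BirchSwinnertonDyer.BirchSwinnertonDyer.Theorems.ThetaPartnerAtTwoSignedControlAtTwoStubPoitouTateShaRat
import Summits.BirchSwinnertonDyer.BirchSwinnertonDyer.Theorems.ThetaPartnerAtTwoSignedControlAtTwoStubPoitouTateSelmerRat
import Summits.BirchSwinnertonDyer.BirchSwinnertonDyer.Theorems.ThetaPartnerAtTwoSignedControlAtTwoShaThreeBaseH3Units
import Literature.NumberTheory.GaloisCohomology.PoitouTateTwoRealPlacesSurjectiveHolds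
import HarnessLib

/-!
# COUNT♭@2 door v11 — NO named fact, NO displayed local input: the four generic Poitou–Tate rows over `ℚ` of door v10
# are tree theorems (item stmt-BirchSwinnertonDyer-19097 `SupersingularRankZeroAtTwo`, route `ByReductionTypeAtTwo`, line `flat_uniform_two`)

Seat `bsd-inputs-k4-p1`'s door v10 `SSFlatEC.flatCountTwo_of_poitouTate_all` (module `…SupersingularFlatCountTwoOfPoitouTate`)
derives the COUNT♭@2 clause of the line from the Honda₂ clauses `hg hc hTr hinj hsat` of `stub_allFlatData` and, BY NAME, the four
generic Poitou–Tate rows over `ℚ` {Milne *ADT* I Thm. 4.10 (b) `poitouTate_selmerStructure_duality ℚ`, (a) `poitouTate_sha_tateDual ℚ`,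
(c)₃ `poitouTate_three_realPlaces_injective ℚ`, Cor. 4.16 `poitouTate_two_realPlaces_surjective ℚ`} (Cassels ⟸ PT(b) by the K4 width
seat's `casselsSurjectivity_H1Sigma_of_poitouTate`; `Ш²(ℚ, E[2^∞]) = 0` ⟸ PT(a) + (c)₃ + 4.16).  Since 2026-08-28 11:36Z all four rows
are THEOREMS of the tree: `SignedEC.PoitouTateSelmerRat.stub_poitouTateSelmerRat` (p625615), `SignedEC.PoitouTateShaRat.stub_poitouTateShaRat`
(p629917), `SignedEC.ShaThreeBrauer.poitouTate_three_realPlaces_injective_holds ℚ` (p628282), `poitouTate_two_realPlaces_surjective_holds ℚ`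
(p618871).  This file discharges them:

* **`flatCountTwo_all`** — door v11: `GoodSS W 2`, `κ` cyclotomic with topological generator `γ`, `v ∣ 2`, the Honda₂ clauses
  ⟹ (`Sel_{2^∞}(W/ℚ)` finite → `(Sel♭_∞)_γ` finite → the COUNT♭@2 identity), VERBATIM door v10's conclusion.  Displayed named
  facts: NONE; displayed local input: NONE.

Seat `prover-bsd-wall-tp2-p3-w3` (bsd-wall K4 width 3/3, gen 10), `--supports stmt-BirchSwinnertonDyer-19097`; one `exact`, nothing
re-derived.  HONEST FRAMING: unconditional as a statement about curves satisfying the displayed clauses, but it is ONE door of the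
line `flat_uniform_two` — the registered stubs of 19097 (`stub_ssPub`, `stub_katoPub`, `stub_allFlatData`, `stub_allMuFlatOfNonSurj`,
`stub_allMillerLower`) are untouched; closes no item; BSD is NOT proved by any of this.

References: [GreenbergLNM1716] §4 Prop. 4.13 / p. 122, Lemma 4.7; [MilneADT2006] I Thm. 4.10 (a)(b)(c), Cor. 4.16, Thm. 6.13 (c);
[Sprung2012] §7 Def. 7.9–7.11, Lemma 2.3; [Cassels1964ArithmeticVII] Thm.
-/

set_option autoImplicit false
-- the Theorems namespace of this sub repeats the summit name by design (D-0017 nested layout)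
set_option linter.dupNamespace false

noncomputable section

open scoped Classical NumberField

open NumberField IsDedekindDomain

namespace Summit.BirchSwinnertonDyer.BirchSwinnertonDyer.Theorems.SSFlatEC

open Literature.NumberTheory.EllipticCurves Literature.NumberTheory.GaloisRepresentations
  WeierstrassCurve ZpExtension Literature.NumberTheory.EllipticCurves.Kobayashi2003
  Literature.NumberTheory.EllipticCurves.Sprung2017 Literature.NumberTheory.EllipticCurves.Sprung2012
  Literature.NumberTheory.EllipticCurves.Sprung2024 Literature.NumberTheory.EllipticCurves.IwasawaDual
  Literature.NumberTheory.EllipticCurves.IwasawaAlgebra Literature.NumberTheory.EllipticCurves.GreenbergVatsal2000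
  Literature.NumberTheory.EllipticCurves.Rank1Residual Summit.BirchSwinnertonDyer.Rank1Residual.X5.O1
  Literature.NumberTheory.GaloisCohomology
open Summit.BirchSwinnertonDyer.Rank1Residual.X11b (LocBridge.primaryGaloisModule)
open Literature.NumberTheory.GaloisRepresentations.DiscreteGaloisModule (shaTwo)

variable (W : WeierstrassCurve ℚ) [W.IsElliptic] [W.IsGloballyMinimal]

/-- **DOOR v11 — COUNT♭@2 on the line's Honda₂ clauses with NO named fact**: door v10 `flatCountTwo_of_poitouTate_all` with its
four Poitou–Tate rows over `ℚ` discharged by the tree theorems (4.10 (b), 4.10 (a), 4.10 (c)₃, Cor. 4.16).  Closes nothing; BSD is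
not proved by this.
[cite: GreenbergLNM1716, §4 Prop. 4.13 / p. 122, Lemma 4.7 (pp. 107–108)] [cite: MilneADT2006, Ch. I, Thm. 4.10, Cor. 4.16, Thm. 6.13 (c)]
[cite: Sprung2012, §7 Def. 7.9, Lemma 7.10] -/
theorem flatCountTwo_all (hss : GoodSS W 2) (κ : ZpExtension ℚ 2) (hκ : κ.IsCyclotomic)
    {γ : Field.absoluteGaloisGroup ℚ} (hγ : κ.IsTopGenerator γ) {v : HeightOneSpectrum (𝓞 ℚ)}
    (hv : (2 : 𝓞 ℚ) ∈ v.asIdeal)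
    {g : Field.absoluteGaloisGroup (v.adicCompletion ℚ)} {c : ℕ → localPoints W (v.adicCompletion ℚ)}
    (hg : κ.IsTopGenerator (resGalOfEmb (closureEmb (K := ℚ) (v.adicCompletion ℚ)) g))
    (hc : ∀ n, c n ∈ localLayerPointsOfEmb κ (closureEmb (K := ℚ) (v.adicCompletion ℚ)) W n)
    (hTr : ∀ n, 1 ≤ n → localTraceOfEmb κ (closureEmb (K := ℚ) (v.adicCompletion ℚ)) W n (n + 1)
      (c (n + 1)) = W.frobeniusTrace 2 • c n - c (n - 1))
    (hinj : ∀ z₀ : localLayerPointsOfEmb κ (closureEmb (K := ℚ) (v.adicCompletion ℚ)) W 0 →+ ℤ_[2],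
      evalOn W (localLayerPointsOfEmb κ (closureEmb (K := ℚ) (v.adicCompletion ℚ)) W 0) z₀ (c 0) = 0 →
        z₀ = 0)
    (hsat : ∀ a : ℤ_[2],
      (∃ z₀ : localLayerPointsOfEmb κ (closureEmb (K := ℚ) (v.adicCompletion ℚ)) W 0 →+ ℤ_[2],
        evalOn W (localLayerPointsOfEmb κ (closureEmb (K := ℚ) (v.adicCompletion ℚ)) W 0) z₀ (c 0) =
          2 * a) →
      ∃ y : localLayerPointsOfEmb κ (closureEmb (K := ℚ) (v.adicCompletion ℚ)) W 0 →+ ℤ_[2],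
        evalOn W (localLayerPointsOfEmb κ (closureEmb (K := ℚ) (v.adicCompletion ℚ)) W 0) y (c 0) = a) :
    Finite (W.selmerGroupPInfty 2) →
      Finite (EndCoinvariants (conjSharpFlatSelmerInfty W κ (closureEmb (K := ℚ) (v.adicCompletion ℚ))
        (W.frobeniusTrace 2) g c .flat γ - 1)) →
      Nat.card (↥((sharpFlatSelmerInfty W κ (closureEmb (K := ℚ) (v.adicCompletion ℚ))
            (W.frobeniusTrace 2) g c .flat).comap (W.layerToInfty κ 0)) ⧸
          (W.selmerLayer κ 0).addSubgroupOf
            ((sharpFlatSelmerInfty W κ (closureEmb (K := ℚ) (v.adicCompletion ℚ))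
              (W.frobeniusTrace 2) g c .flat).comap (W.layerToInfty κ 0))) *
        Nat.card (MulAction.fixedPoints (Field.absoluteGaloisGroup ℚ) (W.geomPrimaryTorsion 2)) =
      2 ^ (padicValNat 2 W.tamagawaProduct) *
        Nat.card (EndCoinvariants (conjSharpFlatSelmerInfty W κ
          (closureEmb (K := ℚ) (v.adicCompletion ℚ)) (W.frobeniusTrace 2) g c .flat γ - 1)) :=
  flatCountTwo_of_poitouTate_all W hss κ hκ hγ hv hg hc hTr hinj hsat
    SignedEC.PoitouTateSelmerRat.stub_poitouTateSelmerRat SignedEC.PoitouTateShaRat.stub_poitouTateShaRat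
    (SignedEC.ShaThreeBrauer.poitouTate_three_realPlaces_injective_holds ℚ) (poitouTate_two_realPlaces_surjective_holds ℚ)

end Summit.BirchSwinnertonDyer.BirchSwinnertonDyer.Theorems.SSFlatEC

end
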